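import Literature.RepresentationTheory.MoeglinVignerasWaldspurger1987.RankOneThetaAnisotropicPlaneDichotomy
import Literature.NumberTheory.GelbartRogawski1991.LocalConjugateSectionBigCellScalar
import HarnessLib

/-!
# The see-saw's second block on the `T₁`-model: the big-cell scalar of `s̄₂ = conj (scaleTransport (restrictRight s))` is the
# conjugate of the scalar of `restrictRight s`

Topic `RepresentationTheory/MoeglinVignerasWaldspurger1987`; namespace `Literature.RepresentationTheory.MoeglinVignerasWaldspurger1987` (that of ★
`RankOneThetaAnisotropicPlaneDichotomy`).  THEOREMS ONLY (no definition, no named fact, no `sorry`, no instance, no notation).  Cell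
`hodgecm-mathlib`, road «L1 pin» (P) of [Liu2021, Lem. D.1 (1)] (LD2-plan (g2) DEALS #1b ∕ #2, brick (F2) composite); `--supports stmt-HodgeConjecture-24832`.

SETTING = ★ `rankOne_theta_anisotropicPlane_dichotomy` (§1 `Plane`): the plane `J = (T₁ ⊕ T₂) ⊗ 1`, `T₂ = a•T₁`, a section `s` over `ι_v` on
`U(J)(F_v)`; in its proof the second block is read on `U(J₁)(F_v)` in the `T₁`-model through THREE sections — `s₂ = restrictRight s` (over
`ι^{T₂}_δ` on `U(J₂)`), `š₂ = scaleTransportSection s₂` (over `ι^{T₁}_{a⁻¹δ}` on `U(J₁)`, ★ `LocalScaleModelTransport`) and a conjugate section `s̄₂` of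
`š₂` (over `ι^{T₁}_{−a⁻¹δ}`, ★ `exists_conjSection`), the last being the one fed to ★ `rankOne_theta_dichotomy`.  The big-cell scalar that ★
`rankOne_torusTrace_eq_explicit` asks of `s̄₂` («THE `λ` with `ω_{s̄₂}(k) = λ · r(e_{T₁} ι^{T₁}_{−a⁻¹δ}(k) e_{T₁}⁻¹)`») is the COMPLEX CONJUGATE of the scalar of
`s₂` at the retyped element:

* `toRep_conjBlockTwo_eq_conj_smul_bigCellOp` — hypothesis on `ω_{s₂}(scaleInl k)` (★ p849973 `toRep_conjSection_eq_conj_smul_bigCellOp` at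
  `N = 1`, `s′ := restrictRight s`);
* `toRep_conjBlockTwo_eq_conj_smul_bigCellOp_of_localCenter` — the same with the hypothesis on `ω_{s₂}(c₂ k)`, `c₂ = localCenter : U(J₁) → U(J₂)` the
  rank-one centre map of the see-saw (★ `localCenter_one_eq_scaleInl`).

So of the two scalars `λ₁ (s₁ = restrictLeft s)`, `λ₂ (s̄₂)` whose quotient pins the dichotomy character `θ` (`χ₀ = θ⁻¹`), the second is
`conj λ_{restrictRight s}` — both are now scalars of BLOCK RESTRICTIONS of `s` itself (brick (F1) computes them for the CM section).  HC_CM is proved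
only modulo the printed citations (2 remaining named inputs hLiu418 = stmt-HodgeConjecture-24832, h413 = 24833) until rung 0 closes; count-neutral.

## References
* [MoeglinVignerasWaldspurger1987] C. Mœglin, M.-F. Vignéras, J.-L. Waldspurger, LNM 1291 (1987), Chap. 2 II.1 (A)–(B), Remarque, Rem. (6); Chap. 3 §IV.4.
* [Weil1964] A. Weil, Acta Math. 111 (1964), n° 13 (29) p. 160, n° 34 p. 182.
* [HarrisKudlaSweet1996] M. Harris, S. Kudla, W. J. Sweet, J. AMS 9 (1996), §1 (1.4), (1.9), Prop. 5.1 (iii).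
* [Liu2021] Y. Liu, Camb. J. Math. 9 (2021), App. D Lem. D.1 (1) (p. 125, l. 5229).
-/

set_option autoImplicit false

noncomputable section

open NumberField IsDedekindDomain MeasureTheory
open scoped TensorProduct Matrix ComplexConjugate
open Literature.RepresentationTheory.HeisenbergGroup
open Literature.NumberTheory.GelbartRogawski1991.UnitaryDualPair.LocalSplitting
open Literature.NumberTheory.GelbartRogawski1991.UnitaryDualPair.LocalSplitting.BlockSum
open Literature.NumberTheory.Automorphic
open Literature.NumberTheory.Automorphic.Liu2021

namespace Literature.RepresentationTheory.MoeglinVignerasWaldspurger1987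

section Plane

variable (F : Type) [Field F] [NumberField F] (E : Type) [Field E] [NumberField E] [Algebra F E]
  [Algebra.IsQuadraticExtension F E] (c : E ≃ₐ[F] E) {δ : E} (hcδ : c δ = -δ) (hδ : δ ≠ 0) {d : F}
  (hd : δ * δ = algebraMap F E d) (v : HeightOneSpectrum (𝓞 F))
  {T₁ T₂ : Matrix (Fin 1) (Fin 1) F} (hT₁ : T₁.IsSymm) (hT₂ : T₂.IsSymm) (hT₁d : IsUnit T₁.det) (hT₂d : IsUnit T₂.det)
  (a : Fˣ) (hTT' : T₂ = (a : F) • T₁)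
  {J₁ J₂ : Matrix (Fin 1) (Fin 1) E} (hJ₁ : J₁ = T₁.map (algebraMap F E)) (hJ₂ : J₂ = T₂.map (algebraMap F E))
  {J : Matrix (Fin (1 + 1)) (Fin (1 + 1)) E} (hJ : J = (UnitaryGroup.finSum 1 1 T₁ T₂).map (algebraMap F E))
  (s : UnitaryGroup.localPi E c (1 + 1) J v →* LocalMp F (1 + 1) (UnitaryGroup.finSum 1 1 T₁ T₂) v)
  (hs : ∀ g, MpPsi.proj _ (s g) =
    iota F E c (1 + 1) hcδ hδ hd (UnitaryGroup.finSum 1 1 T₁ T₂) (UnitaryGroup.isSymm_finSum hT₁ hT₂) hJ v g)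
  {ψ : AddChar (v.adicCompletion F) Circle} (hl : IsLocallyConstant (⇑ψ : v.adicCompletion F → Circle))
  [MeasurableSpace (v.adicCompletion F)] [BorelSpace (v.adicCompletion F)] (μ : Measure (v.adicCompletion F)) [μ.IsAddHaarMeasure]
  {m : ℤ} (hψ : ψ.IsContinuousNontrivial) (hm : ψ.HasConductorExp m)
  (sbar : UnitaryGroup.localPi E c 1 J₁ v →* LocalMp F 1 T₁ v)
  (hsbar : ∀ g, MpPsi.toOp _ (sbar g) =
    conjOp (MpPsi.toOp _ (scaleTransportSection F E c 1 hcδ hδ hd T₁ T₂ hT₁ hT₂ a hTT' hJ₁ hJ₂ v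
      (restrictRight F E c v 1 1 hJ₂ hJ hcδ hδ hd hT₁ hT₂ hT₁d s hs) (proj_restrictRight F E c v 1 1 hJ₂ hJ hcδ hδ hd hT₁ hT₂ hT₁d s hs) g)))
  (k : UnitaryGroup.localPi E c 1 J₁ v)
  (hB : Function.Bijective (blockB (symplecticConj
      (gramProd (localGram F 1 T₁ v) (UnitaryGroup.isUnit_det_map (algebraMap F (v.adicCompletion F)) hT₁d))
      (polar_dotProductBilin_gramProd (localGram F 1 T₁ v) (UnitaryGroup.isUnit_det_map (algebraMap F (v.adicCompletion F)) hT₁d))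
      (iota F E c 1 (conj_lineDelta hcδ a) (lineDelta_ne_zero hδ a) (lineDelta_mul_self hd a) T₁ hT₁ hJ₁ v k)).1))
  (lam : ℂ)

include hTT' hsbar hB in
/-- **THE SECOND BLOCK'S BIG-CELL SCALAR ON THE `T₁`-MODEL** (hypothesis at the retyped element `scaleInl k ∈ U(J₂)(F_v)`): if
`ω_{restrictRight s}(scaleInl k) = λ · r(e_{T₂} ι^{T₂}_δ(scaleInl k) e_{T₂}⁻¹)` (big cell), then for every conjugate section `s̄₂` of
`scaleTransportSection (restrictRight s)`, `ω_{s̄₂}(k) = conj λ · r(e_{T₁} ι^{T₁}_{−a⁻¹δ}(k) e_{T₁}⁻¹)`.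
[cite: MoeglinVignerasWaldspurger1987, Chap. 2 II.1 (A)–(B) and Remarque; Chap. 3 §IV.4] [cite: Weil1964, n° 13 (29), p. 160; n° 34, p. 182] -/
theorem toRep_conjBlockTwo_eq_conj_smul_bigCellOp
    (hlam : ∀ f : SchwartzBruhat (Fin 1 → v.adicCompletion F),
      ((MpPsi.toRep (localSchrodinger F 1 T₂ v)).comp (restrictRight F E c v 1 1 hJ₂ hJ hcδ hδ hd hT₁ hT₂ hT₁d s hs))
          (scaleInl F E c 1 T₁ T₂ a hTT' hJ₁ hJ₂ v k) f =
        lam • bigCellOp hl μ hψ hm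
          (symplecticConj (gramProd (localGram F 1 T₂ v) (UnitaryGroup.isUnit_det_map (algebraMap F (v.adicCompletion F)) hT₂d))
            (polar_dotProductBilin_gramProd (localGram F 1 T₂ v) (UnitaryGroup.isUnit_det_map (algebraMap F (v.adicCompletion F)) hT₂d))
            (iota F E c 1 hcδ hδ hd T₂ hT₂ hJ₂ v (scaleInl F E c 1 T₁ T₂ a hTT' hJ₁ hJ₂ v k))) f)
    (f : SchwartzBruhat (Fin 1 → v.adicCompletion F)) :
    ((MpPsi.toRep (localSchrodinger F 1 T₁ v)).comp sbar) k f =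
      conj lam • bigCellOp hl μ hψ hm
        (symplecticConj (gramProd (localGram F 1 T₁ v) (UnitaryGroup.isUnit_det_map (algebraMap F (v.adicCompletion F)) hT₁d))
          (polar_dotProductBilin_gramProd (localGram F 1 T₁ v) (UnitaryGroup.isUnit_det_map (algebraMap F (v.adicCompletion F)) hT₁d))
          (iota F E c 1 (conj_lineDelta (conj_lineDelta hcδ a) (-1)) (lineDelta_ne_zero (lineDelta_ne_zero hδ a) (-1))
            (lineDelta_mul_self (lineDelta_mul_self hd a) (-1)) T₁ hT₁ hJ₁ v k)) f :=
  toRep_conjSection_eq_conj_smul_bigCellOp F E c 1 hcδ hδ hd T₁ T₂ hT₁ hT₂ hT₁d hT₂d a hTT' hJ₁ hJ₂ v hl μ hψ hm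
    (restrictRight F E c v 1 1 hJ₂ hJ hcδ hδ hd hT₁ hT₂ hT₁d s hs) (proj_restrictRight F E c v 1 1 hJ₂ hJ hcδ hδ hd hT₁ hT₂ hT₁d s hs)
    sbar hsbar k hB lam hlam f

include hTT' hsbar hB in
/-- **The same with the hypothesis at the CENTRE-MAP element `c₂ k`** (`c₂ = localCenter : U(J₁)(F_v) → U(J₂)(F_v)`, `z ↦ z·1`, which for rank one IS
`scaleInl`, ★ `localCenter_one_eq_scaleInl`): the form in which the see-saw ★ `omega_block_two_comp_localCenter_eq` presents the second block.
[cite: MoeglinVignerasWaldspurger1987, Chap. 2 II.1 Rem. (6); Chap. 3 §IV.4] [cite: HarrisKudlaSweet1996, §1 (1.4), (1.9)] -/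
theorem toRep_conjBlockTwo_eq_conj_smul_bigCellOp_of_localCenter (hJ₁0 : J₁ 0 0 ≠ 0)
    (hlam : ∀ f : SchwartzBruhat (Fin 1 → v.adicCompletion F),
      ((MpPsi.toRep (localSchrodinger F 1 T₂ v)).comp (restrictRight F E c v 1 1 hJ₂ hJ hcδ hδ hd hT₁ hT₂ hT₁d s hs))
          (UnitaryGroup.localCenter E c 1 J₂ J₁ hJ₁0 v k) f =
        lam • bigCellOp hl μ hψ hm
          (symplecticConj (gramProd (localGram F 1 T₂ v) (UnitaryGroup.isUnit_det_map (algebraMap F (v.adicCompletion F)) hT₂d))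
            (polar_dotProductBilin_gramProd (localGram F 1 T₂ v) (UnitaryGroup.isUnit_det_map (algebraMap F (v.adicCompletion F)) hT₂d))
            (iota F E c 1 hcδ hδ hd T₂ hT₂ hJ₂ v (UnitaryGroup.localCenter E c 1 J₂ J₁ hJ₁0 v k))) f)
    (f : SchwartzBruhat (Fin 1 → v.adicCompletion F)) :
    ((MpPsi.toRep (localSchrodinger F 1 T₁ v)).comp sbar) k f =
      conj lam • bigCellOp hl μ hψ hm
        (symplecticConj (gramProd (localGram F 1 T₁ v) (UnitaryGroup.isUnit_det_map (algebraMap F (v.adicCompletion F)) hT₁d))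
          (polar_dotProductBilin_gramProd (localGram F 1 T₁ v) (UnitaryGroup.isUnit_det_map (algebraMap F (v.adicCompletion F)) hT₁d))
          (iota F E c 1 (conj_lineDelta (conj_lineDelta hcδ a) (-1)) (lineDelta_ne_zero (lineDelta_ne_zero hδ a) (-1))
            (lineDelta_mul_self (lineDelta_mul_self hd a) (-1)) T₁ hT₁ hJ₁ v k)) f := by
  rw [localCenter_one_eq_scaleInl E c T₁ T₂ a hTT' hJ₁ hJ₂ hJ₁0 v] at hlam
  exact toRep_conjBlockTwo_eq_conj_smul_bigCellOp F E c hcδ hδ hd v hT₁ hT₂ hT₁d hT₂d a hTT' hJ₁ hJ₂ hJ s hs hl μ hψ hm sbar hsbar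
    k hB lam hlam f

end Plane

end Literature.RepresentationTheory.MoeglinVignerasWaldspurger1987

end
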